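import Literature.Probability.Percolation.IsoradialRectangularCrossings
import Literature.Probability.Percolation.IsoradialRectangularLoops
import Literature.Probability.Percolation.QuadCrossingMeasurability
import Literature.Probability.Percolation.QuadCrossingRotationInvarianceOfCoupling
import HarnessLib

/-!
# DKKMO Theorem 2.1 (`q = 1`) on quad crossings: proved bookkeeping towards the discharge

Topic `Probability/Percolation`; sibling proofs file of `IsoradialRectangularCrossings.lean`,
whose named fact `DKKMO2020_thm21_quadCrossingProb` vendors Duminil-Copin–Kozlowski–Krachun–
Manolescu–Oulamara, *Rotational invariance in critical planar lattice models*,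
arXiv:2012.11672v1, Theorem 2.1 at `q = 1` (= v2 (2026), Theorem 1.7), read on the
Schramm–Smirnov crossing event of a quad: for every quad `Q` and `ε > 0` there is `δ₀ > 0`
with `|P_{𝕃(α)}[𝒞_δ(Q) on δ𝕃(α)] - P_{𝕃(π/2)}[𝒞_δ(Q) on δ𝕃(π/2)]| ≤ ε` for all
`α ∈ (ε, π - ε)`, `δ ∈ (0, δ₀)`.

The printed proof of Theorem 2.1 is the body of the paper: Theorem 2.3 (universality in the
homotopy distance `d_H`, §3–§4, §6: star–triangle track exchanges) and Theorem 2.2 (`d_H`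
controls `d_CN`; "the version for the Schramm–Smirnov distance follows readily from known
implications between the former and the latter [CamNew06]", §5.2 p. 25), the crossing
probabilities being read off a `d_SS`-coupling by "the measurability of `𝒞(Q)` in the
Schramm–Smirnov topology" (§7.1, p. 43). In the tree the theorem is the (undischarged) named
fact `dkkmo_theorem_1_7` of `LoopRepresentation.lean` (the printed `d_CN` statement, v2
Thm. 1.7), stated for the measures `isoRectPercolation α` and the embedded lattice
`isoRectPoint δ α` of `IsoradialRectangularLoops.lean`, which the light statement file does not
import. This file proves, sorry-free and without introducing any named fact, the steps of that
road which are bookkeeping: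

* **same objects** (`isoRectCriticalProb_eq_isoRectWeight`, `prodBernoulli_isoRectCriticalProb`,
  `ofReal_mul_isoRectDrawing`, `openEdgeUnionEmb_isoRectDrawing`): the measure
  `prodBernoulli (isoRectCriticalProb α)` of the fact IS `isoRectPercolation α` (and critical bond
  percolation `bondPercolation (zdGraph 2) half` at `α = π/2`), and the lattice drawn at mesh `δ`
  along `isoRectDrawing α` IS `δ𝕃(α)` = `isoRectPoint δ α` (the image of `δℤ²` under
  `isoRectLinear α`), so the fact speaks about exactly the objects of `dkkmo_theorem_1_7`;
* **the `π/2` side is the sibling's crossing probability** (`quadCrossingEmb_map_eq_of_image`,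
  `quadCrossingEmb_isoRectDrawing_pi_div_two`, `measureReal_quadCrossingEmb_pi_div_two`):
  `𝕃(π/2) = e^{iπ/4}√2 ℤ²`, so `P_{𝕃(π/2)}[𝒞_δ(Q) on δ𝕃(π/2)] = P_{1/2}[𝒞_{√2 δ}(e^{-iπ/4} Q)]`
  = `quadCrossingProb (√2 δ) (rotateQuad (-(π/4)) R)` of `QuadCrossingRotationInvariance.lean`;
* **locality and measurability** of the crossing event `quadCrossingEmb z R δ` for a lattice
  drawn along any embedding `z` with finite fibres over discs and bounded edge lengths
  (`measurableSet_quadCrossingEmb`), in particular along `isoRectDrawing α`, `α ∈ (0, π)`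
  (`measurableSet_quadCrossingEmb_isoRectDrawing`) — the generalisation of
  `measurableSet_quadCrossing` (`QuadCrossingMeasurability.lean`) that any comparison of the two
  probabilities under a coupling needs;
* **the trivial regime** `ε ≥ 1` of the fact (`DKKMO2020_thm21_bound_of_one_le`);
* **the reduction to a crossing coupling** (`DKKMO2020_thm21_quadCrossingProb_of_coupling`):
  if for every quad and `ε > 0`, for `α ∈ (ε, π - ε)` and `δ < δ₀(Q, ε)`, the two percolations
  can be coupled so that the crossing indicators of `Q` on `δ𝕃(α)` and on `δ𝕃(π/2)` disagree
  with probability `≤ ε` — which is what Theorem 2.1's `d_SS`-coupling gives on a fixed quad by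
  the a.s. continuity of `𝒞(Q)` (§7.1 p. 43) — then the fact holds (coupling inequality
  `abs_measureReal_sub_le_of_coupling` of `QuadCrossingRotationInvarianceOfCoupling.lean`).

What is NOT here: the crossing coupling itself, i.e. the content of Theorem 2.1 — the
universality theorem `dkkmo_theorem_1_7` (undischarged) together with the passage from a
`d_CN`-close coupling of the loop representations to agreeing crossing indicators (Theorem 2.2
and the continuity of `𝒞(Q)`, resting on Russo–Seymour–Welsh bounds for `𝕃(α)` uniform in `α`,
Theorem 3.2 of the paper). No named fact is introduced.

## References

* [DKKMO2020Rotational] H. Duminil-Copin, K. K. Kozlowski, D. Krachun, I. Manolescu,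
  M. Oulamara, arXiv:2012.11672v1 (2020): §2.1–2.2 p. 7 (`𝕃(α)`, weights, Thm. 2.1), §5.2
  p. 25 (Thm. 2.2, `d_CN` vs `d_SS`), §7.1 p. 43 (crossing probabilities from a coupling);
  v2 (2026) §1.4, Thm. 1.7 [arXiv201211672v2].
* [GrimmettPercolation1999] G. Grimmett, *Percolation*, 2nd ed. (1999), §2.1 (events depending
  on finitely many edges).
-/

noncomputable section

open MeasureTheory Set
open scoped symmDiff Real
open Literature.Probability.LatticeModels Literature.Probability.RandomPlanarGeometry

namespace Literature.Probability.Percolation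

/-! ### The measures of the fact are the `isoRectPercolation α` of `dkkmo_theorem_1_7` -/

/-- The horizontality test of `isoRectCriticalProb` is the predicate `IsHorizontal` of
`IsoradialRectangularLoops`. [folklore] -/
theorem exists_eq_mk_and_iff_isHorizontal (e : Sym2 (Site 2)) :
    (∃ x y : Site 2, e = s(x, y) ∧ x 1 = y 1) ↔ IsHorizontal e := by
  induction e using Sym2.ind with
  | _ a b =>
    rw [isHorizontal_mk]
    constructor
    · rintro ⟨x, y, hxy, h⟩
      rcases Sym2.eq_iff.1 hxy with ⟨rfl, rfl⟩ | ⟨rfl, rfl⟩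
      · exact h
      · exact h.symm
    · exact fun h => ⟨a, b, rfl, h⟩

/-- The canonical `q = 1` weights of the light statement file are the `isoRectWeight α` of
`IsoradialRectangularLoops` (same formula, `IsHorizontal` spelled out).
[cite: DKKMO2020Rotational, §2.2 p. 7] -/
theorem isoRectCriticalProb_eq_isoRectWeight (α : ℝ) : isoRectCriticalProb α = isoRectWeight α := by
  funext e
  unfold isoRectCriticalProb isoRectWeight
  by_cases he : e ∈ (zdGraph 2).edgeSet
  · rw [if_pos he, if_pos he]
    by_cases hh : IsHorizontal e
    · rw [if_pos ((exists_eq_mk_and_iff_isHorizontal e).2 hh), if_pos hh]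
    · rw [if_neg (mt (exists_eq_mk_and_iff_isHorizontal e).1 hh), if_neg hh]
  · rw [if_neg he, if_neg he]

/-- **Same measure.** `φ_{𝕃(α)}` at `q = 1` as rendered by the fact,
`prodBernoulli (isoRectCriticalProb α)`, is the measure `isoRectPercolation α` of
`dkkmo_theorem_1_7`. [cite: DKKMO2020Rotational, §2.2 p. 7] -/
theorem prodBernoulli_isoRectCriticalProb (α : ℝ) :
    prodBernoulli (isoRectCriticalProb α) = isoRectPercolation α := by
  rw [isoRectCriticalProb_eq_isoRectWeight]
  rfl

/-- At `α = π/2` the measure of the fact is critical bond percolation on `ℤ²`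
(`isoRectPercolation_pi_div_two`). [cite: DKKMO2020Rotational, §2.1 p. 7] -/
theorem prodBernoulli_isoRectCriticalProb_pi_div_two :
    prodBernoulli (isoRectCriticalProb (π / 2)) = bondPercolation (zdGraph 2) half := by
  rw [prodBernoulli_isoRectCriticalProb, isoRectPercolation_pi_div_two]

/-! ### The drawn lattice of the fact is `δ𝕃(α) = isoRectPoint δ α` -/

/-- Real part of the axis-parallel embedding. [folklore] -/
theorem isoRectEmbedding_re (α : ℝ) (x : Site 2) :
    (isoRectEmbedding α x).re = 2 * Real.cos (α / 2) * x 0 := by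
  simp only [isoRectEmbedding, Complex.add_re, Complex.mul_re, Complex.mul_im, Complex.ofReal_re,
    Complex.ofReal_im, Complex.intCast_re, Complex.intCast_im, Complex.I_re, Complex.I_im]
  ring

/-- Imaginary part of the axis-parallel embedding. [folklore] -/
theorem isoRectEmbedding_im (α : ℝ) (x : Site 2) :
    (isoRectEmbedding α x).im = 2 * Real.sin (α / 2) * x 1 := by
  simp only [isoRectEmbedding, Complex.add_im, Complex.mul_re, Complex.mul_im, Complex.ofReal_re,
    Complex.ofReal_im, Complex.intCast_re, Complex.intCast_im, Complex.I_re, Complex.I_im]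
  ring

/-- DKKMO's position of `𝕃(α)` on lattice points is the real-linear map `isoRectLinear α` of
`IsoradialRectangularLoops` applied to `ℤ² ⊆ ℂ`. [cite: DKKMO2020Rotational, §2.1 p. 7] -/
theorem isoRectDrawing_eq_isoRectLinear (α : ℝ) (x : Site 2) :
    isoRectDrawing α x = isoRectLinear α (Site.toComplex x) := by
  rw [isoRectLinear_apply, Site.toComplex_re, Site.toComplex_im, isoRectDrawing, isoRectEmbedding]
  push_cast
  ring

/-- **Same lattice.** The vertex `x` of the lattice drawn at mesh `δ` along `isoRectDrawing α`
is the vertex `isoRectPoint δ α x` of `δ𝕃(α)` used by the loop representation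
`isoRectLoopConfig δ α` of `dkkmo_theorem_1_7`. [cite: DKKMO2020Rotational, §2.1 p. 7] -/
theorem ofReal_mul_isoRectDrawing (δ α : ℝ) (x : Site 2) :
    (δ : ℂ) * isoRectDrawing α x = isoRectPoint δ α x := by
  rw [isoRectPoint, meshPoint, isoRectDrawing_eq_isoRectLinear, ← Complex.real_smul,
    ← Complex.real_smul, map_smul]

/-- The open edges drawn at mesh `δ` along `isoRectDrawing α` are the segments of `δ𝕃(α)`
between the `isoRectPoint`s of the open lattice edges. [cite: DKKMO2020Rotational, §1.2 p. 4] -/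
theorem openEdgeUnionEmb_isoRectDrawing (δ α : ℝ) (ω : BondConfig (Site 2)) :
    openEdgeUnionEmb (isoRectDrawing α) δ ω =
      ⋃ (x : Site 2) (y : Site 2) (_ : (zdGraph 2).Adj x y) (_ : s(x, y) ∈ ω),
        segment ℝ (isoRectPoint δ α x) (isoRectPoint δ α y) := by
  simp only [openEdgeUnionEmb, ofReal_mul_isoRectDrawing]

/-- A real-linear map of the plane maps segments onto segments. [folklore] -/
theorem image_isoRectLinear_segment (α : ℝ) (a b : ℂ) :
    isoRectLinear α '' segment ℝ a b = segment ℝ (isoRectLinear α a) (isoRectLinear α b) := by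
  have h := image_segment ℝ ((isoRectLinear α : ℂ →ₗ[ℝ] ℂ).toAffineMap) a b
  simpa using h

/-- The open edges drawn along `isoRectDrawing α` at mesh `δ` are the image under
`isoRectLinear α` of the open edges of `δℤ²` (`openEdgeUnion δ ω` of the sibling).
[cite: DKKMO2020Rotational, §2.1 p. 7] -/
theorem openEdgeUnionEmb_isoRectDrawing_eq_image (δ α : ℝ) (ω : BondConfig (Site 2)) :
    openEdgeUnionEmb (isoRectDrawing α) δ ω = isoRectLinear α '' openEdgeUnion δ ω := by
  rw [openEdgeUnionEmb_isoRectDrawing]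
  simp only [openEdgeUnion, image_iUnion, image_isoRectLinear_segment, isoRectPoint]

/-! ### The `π/2` side is the sibling's crossing probability of `e^{-iπ/4} Q` at mesh `√2 δ` -/

/-- **Transport of the crossing event along a plane homeomorphism.** If the open edges drawn
along `z` at mesh `δ` are, configuration by configuration, the image under the homeomorphism
`L` of the open edges of `δ'ℤ²`, then the image quad `L(Q)` is crossed inside the lattice
drawn along `z` iff `Q` is crossed inside `δ'ℤ²` (a crossing is carried by `L`, and back by
`L⁻¹`). [folklore] -/
theorem quadCrossingEmb_map_eq_of_image (L : ℂ ≃ₜ ℂ) {z : Site 2 → ℂ} {δ δ' : ℝ}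
    (hL : ∀ ω, openEdgeUnionEmb z δ ω = L '' openEdgeUnion δ' ω) (R : ConformalRectangle) :
    quadCrossingEmb z (R.map L) δ = quadCrossing R δ' := by
  ext ω
  simp only [quadCrossingEmb, mem_setOf_eq, mem_quadCrossing_iff, MarkedDomain.arc_map,
    MarkedDomain.carrier_map, hL ω, ← L.image_closure, ← image_inter L.injective]
  constructor
  · rintro ⟨_, ⟨a, ha, rfl⟩, _, ⟨b, hb, rfl⟩, hj⟩
    refine ⟨a, ha, b, hb, ?_⟩
    have h := hj.map L.symm.continuous
    simpa only [image_image, Homeomorph.symm_apply_apply, image_id'] using h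
  · rintro ⟨a, ha, b, hb, hj⟩
    exact ⟨L a, mem_image_of_mem _ ha, L b, mem_image_of_mem _ hb, hj.map L.continuous⟩

/-- `δ𝕃(π/2) = e^{iπ/4} (√2 δ) ℤ²`: the open edges drawn along `isoRectDrawing (π/2)` at mesh
`δ` are the open edges of `(√2 δ)ℤ²` rotated by `π/4` ("`𝕃(π/2)` is simply a rescaled and
rotated (by an angle of `π/4`) version of `ℤ²`"). [cite: DKKMO2020Rotational, §2.1 p. 7] -/
theorem openEdgeUnionEmb_isoRectDrawing_pi_div_two (δ : ℝ) (ω : BondConfig (Site 2)) :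
    openEdgeUnionEmb (isoRectDrawing (π / 2)) δ ω =
      (rotation (Circle.exp (π / 4))).toHomeomorph '' openEdgeUnion (Real.sqrt 2 * δ) ω := by
  have hfun : ((rotation (Circle.exp (π / 4))).toHomeomorph : ℂ → ℂ) =
      fun z => Complex.exp (((π / 4 : ℝ) : ℂ) * Complex.I) * z := by
    funext z
    rw [LinearIsometryEquiv.coe_toHomeomorph, rotation_apply, Circle.coe_exp]
  have hpt : ∀ x : Site 2, Complex.exp (((π / 4 : ℝ) : ℂ) * Complex.I) * meshPoint (Real.sqrt 2 * δ) x =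
      (δ : ℂ) * isoRectDrawing (π / 2) x := fun x => by
    rw [isoRectDrawing_pi_div_two, meshPoint]
    simp only [squareLatticeEmbedding]
    push_cast
    ring
  simp only [openEdgeUnionEmb, openEdgeUnion, image_iUnion, hfun, image_mul_left_segment, hpt]

/-- **The `π/2` side of the fact is the sibling's crossing event**: `Q` is crossed inside the
open edges of `δ𝕃(π/2)` iff the quad `e^{-iπ/4} Q` is crossed inside the open edges of
`(√2 δ)ℤ²` (`quadCrossing` of `QuadCrossingRotationInvariance.lean`).
[cite: DKKMO2020Rotational, §2.1 p. 7] -/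
theorem quadCrossingEmb_isoRectDrawing_pi_div_two (R : ConformalRectangle) (δ : ℝ) :
    quadCrossingEmb (isoRectDrawing (π / 2)) R δ =
      quadCrossing (rotateQuad (-(π / 4)) R) (Real.sqrt 2 * δ) := by
  have hR : R = (rotateQuad (-(π / 4)) R).map (rotation (Circle.exp (π / 4))).toHomeomorph := by
    change R = rotateQuad (π / 4) (rotateQuad (-(π / 4)) R)
    rw [← rotateQuad_add, neg_add_cancel, rotateQuad_zero]
  conv_lhs => rw [hR]
  exact quadCrossingEmb_map_eq_of_image _ (openEdgeUnionEmb_isoRectDrawing_pi_div_two δ) _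

/-- Hence `P_{𝕃(π/2)}[𝒞_δ(Q) on δ𝕃(π/2)] = P_{1/2}[𝒞_{√2 δ}(e^{-iπ/4} Q)] =
quadCrossingProb (√2 δ) (rotateQuad (-(π/4)) R)`. [cite: DKKMO2020Rotational, §2.1 p. 7] -/
theorem measureReal_quadCrossingEmb_pi_div_two (R : ConformalRectangle) (δ : ℝ) :
    (prodBernoulli (isoRectCriticalProb (π / 2))).real
        (quadCrossingEmb (isoRectDrawing (π / 2)) R δ) =
      quadCrossingProb (Real.sqrt 2 * δ) (rotateQuad (-(π / 4)) R) := by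
  rw [prodBernoulli_isoRectCriticalProb_pi_div_two, quadCrossingEmb_isoRectDrawing_pi_div_two]
  rfl

/-! ### Locality and measurability of the crossing event along an embedding -/

section Locality

variable {z : Site 2 → ℂ} {R : ConformalRectangle} {δ : ℝ} {E : Set (Sym2 (Site 2))}

/-- Membership in `openEdgeUnionEmb`, unfolded. [folklore] -/
theorem mem_openEdgeUnionEmb_iff {ω : BondConfig (Site 2)} {p : ℂ} :
    p ∈ openEdgeUnionEmb z δ ω ↔ ∃ x y : Site 2, (zdGraph 2).Adj x y ∧ s(x, y) ∈ ω ∧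
      p ∈ segment ℝ ((δ : ℂ) * z x) ((δ : ℂ) * z y) := by
  simp only [openEdgeUnionEmb, mem_iUnion, exists_prop]

/-- **Locality.** If `E` contains every lattice edge whose drawn segment meets the closed quad,
then inside the closed quad the open edges of `ω` and of `ω ∩ E` draw the same set. [folklore] -/
theorem closure_inter_openEdgeUnionEmb_eq_of_subset
    (hE : ∀ x y : Site 2, (zdGraph 2).Adj x y →
      (segment ℝ ((δ : ℂ) * z x) ((δ : ℂ) * z y) ∩ closure R.carrier).Nonempty → s(x, y) ∈ E)
    (ω : BondConfig (Site 2)) :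
    closure R.carrier ∩ openEdgeUnionEmb z δ ω =
      closure R.carrier ∩ openEdgeUnionEmb z δ (ω ∩ E) := by
  refine Subset.antisymm ?_ (inter_subset_inter_right _ (openEdgeUnionEmb_mono z δ inter_subset_left))
  rintro p ⟨hpR, hp⟩
  obtain ⟨x, y, hxy, hω, hps⟩ := mem_openEdgeUnionEmb_iff.1 hp
  exact ⟨hpR, mem_openEdgeUnionEmb_iff.2 ⟨x, y, hxy, ⟨hω, hE x y hxy ⟨p, hps, hpR⟩⟩, hps⟩⟩

/-- Hence the crossing event depends only on the edges in `E`. [folklore] -/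
theorem mem_quadCrossingEmb_iff_inter_mem
    (hE : ∀ x y : Site 2, (zdGraph 2).Adj x y →
      (segment ℝ ((δ : ℂ) * z x) ((δ : ℂ) * z y) ∩ closure R.carrier).Nonempty → s(x, y) ∈ E)
    (ω : BondConfig (Site 2)) :
    ω ∈ quadCrossingEmb z R δ ↔ ω ∩ E ∈ quadCrossingEmb z R δ := by
  simp only [quadCrossingEmb, mem_setOf_eq, closure_inter_openEdgeUnionEmb_eq_of_subset hE ω]

/-- **Cylinder decomposition** of the (increasing) crossing event over the crossing
sub-configurations of `E`. [folklore] -/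
theorem quadCrossingEmb_eq_biUnion_of_subset
    (hE : ∀ x y : Site 2, (zdGraph 2).Adj x y →
      (segment ℝ ((δ : ℂ) * z x) ((δ : ℂ) * z y) ∩ closure R.carrier).Nonempty → s(x, y) ∈ E) :
    quadCrossingEmb z R δ = ⋃ S ∈ {S : Set (Sym2 (Site 2)) | S ⊆ E ∧ S ∈ quadCrossingEmb z R δ},
      {ω : BondConfig (Site 2) | S ⊆ ω} := by
  ext ω
  simp only [mem_iUnion, mem_setOf_eq, exists_prop]
  constructor
  · intro hω
    exact ⟨ω ∩ E, ⟨inter_subset_right, (mem_quadCrossingEmb_iff_inter_mem hE ω).1 hω⟩,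
      inter_subset_left⟩
  · rintro ⟨S, ⟨-, hS⟩, hSω⟩
    exact isUpperSet_quadCrossingEmb z R δ hSω hS

/-- With `E` finite the crossing event is measurable (finite union of cylinders). [folklore] -/
theorem measurableSet_quadCrossingEmb_of_subset (hfin : E.Finite)
    (hE : ∀ x y : Site 2, (zdGraph 2).Adj x y →
      (segment ℝ ((δ : ℂ) * z x) ((δ : ℂ) * z y) ∩ closure R.carrier).Nonempty → s(x, y) ∈ E) :
    MeasurableSet (quadCrossingEmb z R δ) := by
  rw [quadCrossingEmb_eq_biUnion_of_subset hE]
  refine Finite.measurableSet_biUnion (hfin.finite_subsets.subset fun S hS => hS.1) fun S hS => ?_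
  have hS : S.Finite := hfin.subset hS.1
  have : {ω : BondConfig (Site 2) | S ⊆ ω} = ⋂ e ∈ S, {ω : BondConfig (Site 2) | e ∈ ω} := by
    ext ω; simp [subset_def]
  rw [this]
  exact hS.measurableSet_biInter fun e _ => measurableSet_mem e

end Locality

/-- For an embedding with finite fibres over discs and drawn edges of bounded length, only
finitely many lattice edges are drawn through the bounded closed quad at mesh `δ > 0`.
[folklore] -/
theorem exists_finite_edges_meeting_quad_emb (z : Site 2 → ℂ)
    (hfib : ∀ r : ℝ, {x : Site 2 | ‖z x‖ ≤ r}.Finite) {M : ℝ}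
    (hM : ∀ x y : Site 2, (zdGraph 2).Adj x y → ‖z x - z y‖ ≤ M)
    (R : ConformalRectangle) {δ : ℝ} (hδ : 0 < δ) :
    ∃ E : Set (Sym2 (Site 2)), E.Finite ∧ ∀ x y : Site 2, (zdGraph 2).Adj x y →
      (segment ℝ ((δ : ℂ) * z x) ((δ : ℂ) * z y) ∩ closure R.carrier).Nonempty → s(x, y) ∈ E := by
  obtain ⟨r, hr⟩ := (Metric.isBounded_iff_subset_closedBall (0 : ℂ)).1 R.isBounded.closure
  set V : Set (Site 2) := {x | ‖z x‖ ≤ r / δ + M} with hV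
  refine ⟨(fun p : Site 2 × Site 2 => s(p.1, p.2)) '' V ×ˢ V, ((hfib _).prod (hfib _)).image _, ?_⟩
  have hmem : ∀ x y : Site 2, (zdGraph 2).Adj x y →
      ∀ p ∈ segment ℝ ((δ : ℂ) * z x) ((δ : ℂ) * z y), p ∈ closure R.carrier → x ∈ V := by
    intro x y hxy p hps hpR
    have hp : ‖p‖ ≤ r := by simpa [dist_zero_right] using hr hpR
    have h1 : ‖p - (δ : ℂ) * z x‖ ≤ ‖(δ : ℂ) * z y - (δ : ℂ) * z x‖ :=
      norm_sub_le_of_mem_segment hps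
    have h2 : ‖(δ : ℂ) * z y - (δ : ℂ) * z x‖ ≤ δ * M := by
      rw [← mul_sub, norm_mul, Complex.norm_real, Real.norm_eq_abs, abs_of_pos hδ, norm_sub_rev]
      exact mul_le_mul_of_nonneg_left (hM x y hxy) hδ.le
    have h3 : δ * ‖z x‖ ≤ r + δ * M := by
      calc δ * ‖z x‖ = ‖(δ : ℂ) * z x‖ := by
            rw [norm_mul, Complex.norm_real, Real.norm_eq_abs, abs_of_pos hδ]
        _ = ‖p - (p - (δ : ℂ) * z x)‖ := by rw [sub_sub_cancel]
        _ ≤ ‖p‖ + ‖p - (δ : ℂ) * z x‖ := norm_sub_le _ _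
        _ ≤ r + δ * M := add_le_add hp (h1.trans h2)
    have h4 : ‖z x‖ - M ≤ r / δ := by
      rw [le_div_iff₀ hδ]
      linarith
    show ‖z x‖ ≤ r / δ + M
    linarith
  rintro x y hxy ⟨p, hps, hpR⟩
  refine ⟨(x, y), ⟨hmem x y hxy p hps hpR, hmem y x hxy.symm p ?_ hpR⟩, rfl⟩
  rwa [segment_symm]

/-- **The crossing event along an embedding is measurable** (`δ > 0`, finite fibres over discs,
bounded drawn edges): a finite union of cylinder events. [folklore] -/
theorem measurableSet_quadCrossingEmb (z : Site 2 → ℂ)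
    (hfib : ∀ r : ℝ, {x : Site 2 | ‖z x‖ ≤ r}.Finite) {M : ℝ}
    (hM : ∀ x y : Site 2, (zdGraph 2).Adj x y → ‖z x - z y‖ ≤ M)
    (R : ConformalRectangle) {δ : ℝ} (hδ : 0 < δ) :
    MeasurableSet (quadCrossingEmb z R δ) := by
  obtain ⟨E, hfin, hE⟩ := exists_finite_edges_meeting_quad_emb z hfib hM R hδ
  exact measurableSet_quadCrossingEmb_of_subset hfin hE

/-! ### The embedding `isoRectDrawing α`: finite fibres, bounded edges, measurability -/

/-- The rotation factor has modulus one: `‖isoRectDrawing α x‖ = ‖isoRectEmbedding α x‖`.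
[folklore] -/
theorem norm_isoRectDrawing (α : ℝ) (x : Site 2) :
    ‖isoRectDrawing α x‖ = ‖isoRectEmbedding α x‖ := by
  rw [isoRectDrawing, norm_mul, Complex.norm_exp_ofReal_mul_I, one_mul]

/-- For `α ∈ (0, π)` the lattice `𝕃(α)` is locally finite in the plane: finitely many vertices in
every disc (both side lengths `2 cos(α/2)`, `2 sin(α/2)` are positive). [folklore] -/
theorem finite_norm_isoRectDrawing_le {α : ℝ} (hα : α ∈ Set.Ioo 0 π) (r : ℝ) :
    {x : Site 2 | ‖isoRectDrawing α x‖ ≤ r}.Finite := by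
  have hc : 0 < Real.cos (α / 2) :=
    Real.cos_pos_of_mem_Ioo ⟨by linarith [hα.1, Real.pi_pos], by linarith [hα.2]⟩
  have hs : 0 < Real.sin (α / 2) :=
    Real.sin_pos_of_pos_of_lt_pi (by linarith [hα.1]) (by linarith [hα.2, Real.pi_pos])
  set m : ℝ := min (2 * Real.cos (α / 2)) (2 * Real.sin (α / 2)) with hm
  have hm0 : 0 < m := lt_min (by linarith) (by linarith)
  refine (Set.Finite.pi (t := fun _ : Fin 2 => Set.Icc (⌊-(r / m)⌋) (⌈r / m⌉))
    fun _ => Set.finite_Icc _ _).subset ?_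
  intro x hx
  rw [mem_setOf_eq, norm_isoRectDrawing] at hx
  have hre := (Complex.abs_re_le_norm _).trans hx
  have him := (Complex.abs_im_le_norm _).trans hx
  rw [isoRectEmbedding_re, abs_mul, abs_of_pos (by linarith : (0 : ℝ) < 2 * Real.cos (α / 2))]
    at hre
  rw [isoRectEmbedding_im, abs_mul, abs_of_pos (by linarith : (0 : ℝ) < 2 * Real.sin (α / 2))]
    at him
  have key : ∀ (a : ℤ) (c : ℝ), m ≤ c → c * |(a : ℝ)| ≤ r →
      a ∈ Set.Icc (⌊-(r / m)⌋) (⌈r / m⌉) := fun a c hc' ha => by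
    have h1 : m * |(a : ℝ)| ≤ r := (mul_le_mul_of_nonneg_right hc' (abs_nonneg _)).trans ha
    have ha' : |(a : ℝ)| ≤ r / m := by rwa [le_div_iff₀ hm0, mul_comm]
    obtain ⟨h1, h2⟩ := abs_le.1 ha'
    exact ⟨Int.cast_le.1 ((Int.floor_le _).trans h1), Int.cast_le.1 (h2.trans (Int.le_ceil _))⟩
  simp only [Set.mem_pi, Set.mem_univ, forall_true_left, Fin.forall_fin_two]
  exact ⟨key _ _ (min_le_left _ _) hre, key _ _ (min_le_right _ _) him⟩

/-- The drawn edges of `𝕃(α)` have length at most `2` (they are `2 cos(α/2)` and `2 sin(α/2)`,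
chords of unit circles). [cite: DKKMO2020Rotational, §2.1 p. 7] -/
theorem norm_isoRectDrawing_sub_le_two (α : ℝ) {x y : Site 2} (h : (zdGraph 2).Adj x y) :
    ‖isoRectDrawing α x - isoRectDrawing α y‖ ≤ 2 := by
  have key : ∀ (u : Site 2) (i : Fin 2),
      ‖isoRectDrawing α (u + Pi.single i 1) - isoRectDrawing α u‖ ≤ 2 := by
    intro u i
    rw [isoRectDrawing, isoRectDrawing, ← mul_sub, norm_mul, Complex.norm_exp_ofReal_mul_I,
      one_mul]
    have hre : (isoRectEmbedding α (u + Pi.single i 1) - isoRectEmbedding α u).re =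
        2 * Real.cos (α / 2) * ((Pi.single i (1 : ℤ) : Site 2) 0 : ℤ) := by
      rw [Complex.sub_re, isoRectEmbedding_re, isoRectEmbedding_re, Pi.add_apply, Int.cast_add]
      ring
    have him : (isoRectEmbedding α (u + Pi.single i 1) - isoRectEmbedding α u).im =
        2 * Real.sin (α / 2) * ((Pi.single i (1 : ℤ) : Site 2) 1 : ℤ) := by
      rw [Complex.sub_im, isoRectEmbedding_im, isoRectEmbedding_im, Pi.add_apply, Int.cast_add]
      ring
    have hsq : ‖isoRectEmbedding α (u + Pi.single i 1) - isoRectEmbedding α u‖ ^ 2 ≤ 2 ^ 2 := by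
      rw [Complex.sq_norm, Complex.normSq_apply, hre, him]
      have h1 := Real.sin_sq_add_cos_sq (α / 2)
      have h2 := Real.sin_sq_le_one (α / 2)
      have h3 := Real.cos_sq_le_one (α / 2)
      fin_cases i <;> simp <;> nlinarith
    exact (pow_le_pow_iff_left₀ (norm_nonneg _) (by norm_num) two_ne_zero).1 hsq
  obtain ⟨i, h | h⟩ := (zdGraph_adj_iff x y).1 h
  · rw [h, norm_sub_rev]
    exact key x i
  · rw [h]
    exact key y i

/-- **The crossing event of the fact is measurable**: for `α ∈ (0, π)` and `δ > 0`,
`quadCrossingEmb (isoRectDrawing α) R δ` is a finite union of cylinder events. [folklore] -/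
theorem measurableSet_quadCrossingEmb_isoRectDrawing {α : ℝ} (hα : α ∈ Set.Ioo 0 π)
    (R : ConformalRectangle) {δ : ℝ} (hδ : 0 < δ) :
    MeasurableSet (quadCrossingEmb (isoRectDrawing α) R δ) :=
  measurableSet_quadCrossingEmb (isoRectDrawing α) (finite_norm_isoRectDrawing_le hα)
    (fun _ _ h => norm_isoRectDrawing_sub_le_two α h) R hδ

/-! ### The trivial regime `ε ≥ 1` -/

/-- Two probabilities differ by at most `1`. [folklore] -/
theorem abs_measureReal_sub_measureReal_le_one {X Y : Type*} [MeasurableSpace X]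
    [MeasurableSpace Y] (μ : Measure X) (ν : Measure Y) [IsProbabilityMeasure μ]
    [IsProbabilityMeasure ν] (A : Set X) (B : Set Y) : |μ.real A - ν.real B| ≤ 1 := by
  rw [abs_sub_le_iff]
  have h1 : 0 ≤ μ.real A := measureReal_nonneg
  have h2 : μ.real A ≤ 1 := measureReal_le_one
  have h3 : 0 ≤ ν.real B := measureReal_nonneg
  have h4 : ν.real B ≤ 1 := measureReal_le_one
  constructor <;> linarith

/-- The trivial regime of `DKKMO2020_thm21_quadCrossingProb`: for `ε ≥ 1` the printed bound
holds for every quad, angle and mesh, both numbers being probabilities; the content of the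
theorem is the regime `ε → 0`. [cite: DKKMO2020Rotational, Thm. 2.1 (q = 1)] -/
theorem DKKMO2020_thm21_bound_of_one_le {ε : ℝ} (hε : 1 ≤ ε) (R : ConformalRectangle)
    (α δ : ℝ) :
    |(prodBernoulli (isoRectCriticalProb α)).real (quadCrossingEmb (isoRectDrawing α) R δ) -
        (prodBernoulli (isoRectCriticalProb (π / 2))).real
          (quadCrossingEmb (isoRectDrawing (π / 2)) R δ)| ≤ ε :=
  (abs_measureReal_sub_measureReal_le_one _ _ _ _).trans hε

/-! ### Reduction of the fact to a coupling of the crossing indicators -/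

/-- **`DKKMO2020_thm21_quadCrossingProb` from the crossing-coupling form of Theorem 2.1.**
Suppose that for every quad `Q` and `ε > 0` there is `δ₀ > 0` such that for every
`α ∈ (ε, π - ε)` and `δ ∈ (0, δ₀)` the percolations `φ_{𝕃(α)}` and `φ_{𝕃(π/2)}` (`q = 1`) can be
coupled so that the events "`Q` is crossed inside `δ𝕃(α)`" for the first configuration and
"`Q` is crossed inside `δ𝕃(π/2)`" for the second disagree with probability at most `ε` — this
is what the `d_SS`-coupling of Theorem 2.1 yields on a fixed quad by the a.s. continuity of
`𝒞(Q)` ("the result follows directly from [the theorem] and the measurability of `𝒞(Q)` in the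
Schramm–Smirnov topology", §7.1 p. 43). Then the fact holds, by the coupling inequality
(`abs_measureReal_sub_le_of_coupling`) and the measurability of both crossing events
(`measurableSet_quadCrossingEmb_isoRectDrawing`, `(ε, π - ε) ⊆ (0, π)` and `π/2 ∈ (0, π)`).
[cite: DKKMO2020Rotational, Thm. 2.1 (q = 1), with §7.1 p. 43] -/
theorem DKKMO2020_thm21_quadCrossingProb_of_coupling
    (H : ∀ (R : ConformalRectangle) (ε : ℝ), 0 < ε → ∃ δ₀ : ℝ, 0 < δ₀ ∧
      ∀ α ∈ Set.Ioo ε (π - ε), ∀ δ ∈ Set.Ioo (0 : ℝ) δ₀,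
        ∃ P : Measure (BondConfig (Site 2) × BondConfig (Site 2)),
          P.map Prod.fst = prodBernoulli (isoRectCriticalProb α) ∧
          P.map Prod.snd = prodBernoulli (isoRectCriticalProb (π / 2)) ∧
          P.real ((Prod.fst ⁻¹' quadCrossingEmb (isoRectDrawing α) R δ) ∆
            (Prod.snd ⁻¹' quadCrossingEmb (isoRectDrawing (π / 2)) R δ)) ≤ ε) :
    DKKMO2020_thm21_quadCrossingProb := by
  intro R ε hε
  obtain ⟨δ₀, hδ₀, h⟩ := H R ε hε
  refine ⟨δ₀, hδ₀, fun α hα δ hδ => ?_⟩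
  obtain ⟨P, h1, h2, hP⟩ := h α hα δ hδ
  haveI : IsProbabilityMeasure P := isProbabilityMeasure_of_map_fst h1
  have hα' : α ∈ Set.Ioo 0 π := ⟨hε.trans hα.1, by linarith [hα.2]⟩
  have hπ : π / 2 ∈ Set.Ioo 0 π := ⟨by positivity, by linarith [Real.pi_pos]⟩
  exact (abs_measureReal_sub_le_of_coupling P h1 h2
    (measurableSet_quadCrossingEmb_isoRectDrawing hα' R hδ.1)
    (measurableSet_quadCrossingEmb_isoRectDrawing hπ R hδ.1)).trans hP

/-- The same reduction with both sides in the vocabulary of `dkkmo_theorem_1_7` and of the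
sibling fact: marginals `isoRectPercolation α`, `isoRectPercolation (π/2)`, and on the `π/2` side
the crossing event `quadCrossing (rotateQuad (-(π/4)) R) (√2 δ)` of `(√2 δ)ℤ²`
(`prodBernoulli_isoRectCriticalProb`, `quadCrossingEmb_isoRectDrawing_pi_div_two`).
[cite: DKKMO2020Rotational, Thm. 2.1 (q = 1), with §7.1 p. 43] -/
theorem DKKMO2020_thm21_quadCrossingProb_of_coupling'
    (H : ∀ (R : ConformalRectangle) (ε : ℝ), 0 < ε → ∃ δ₀ : ℝ, 0 < δ₀ ∧
      ∀ α ∈ Set.Ioo ε (π - ε), ∀ δ ∈ Set.Ioo (0 : ℝ) δ₀,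
        ∃ P : Measure (BondConfig (Site 2) × BondConfig (Site 2)),
          P.map Prod.fst = isoRectPercolation α ∧
          P.map Prod.snd = isoRectPercolation (π / 2) ∧
          P.real ((Prod.fst ⁻¹' quadCrossingEmb (isoRectDrawing α) R δ) ∆
            (Prod.snd ⁻¹' quadCrossing (rotateQuad (-(π / 4)) R) (Real.sqrt 2 * δ))) ≤ ε) :
    DKKMO2020_thm21_quadCrossingProb := by
  refine DKKMO2020_thm21_quadCrossingProb_of_coupling fun R ε hε => ?_
  obtain ⟨δ₀, hδ₀, h⟩ := H R ε hε
  refine ⟨δ₀, hδ₀, fun α hα δ hδ => ?_⟩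
  obtain ⟨P, h1, h2, hP⟩ := h α hα δ hδ
  refine ⟨P, ?_, ?_, ?_⟩
  · rw [h1, prodBernoulli_isoRectCriticalProb]
  · rw [h2, prodBernoulli_isoRectCriticalProb]
  · rwa [quadCrossingEmb_isoRectDrawing_pi_div_two]

end Literature.Probability.Percolation
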